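import Summits.CriticalPhenomena.PercolationContinuityZ3.Theorems.SoloBlindSlitLadder
import Literature.Probability.Percolation.ConnectivityContinuityProofs
import Literature.Probability.Percolation.SharpnessDCTProofs
import HarnessLib

/-!
# The fin criterion is a statement about SUBCRITICAL half-space percolation

Seat `solo-CriticalPhenomena-blind`.  The landed criterion `T₀ ≤ 2 ⟹ FinRung`
(`finRung_of_T0_le_two`) evaluates the half-space boundary-line sum
`T₀ = Σ_{w ≠ 0} P_{p_c}(0 ↔ (0,0,w) inside ℍ)` AT `p_c(ℤ³)`.  Here we transfer it to `p < p_c`: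

* `measure_openConnVia_eq_iSup`, `continuous_measure_openConnVia_inf_fromEdgeSet` — a restricted
  connection event `{x ↔ y via K}` is the increasing union over finite edge sets `F` of the local
  events `{x ↔ y via K ⊓ F}`, each of probability continuous in `p` (any countable graph);
* `T0_le_of_forall_lt` — **left-continuity transfer**: if `T₀(p) ≤ c` for every `p < p_c(ℤ³)` then
  `T₀ = T₀(p_c) ≤ c`; with monotonicity (`T0At_mono`) in fact `T₀ = sup_{p < p_c} T₀(p)`
  (`T0_eq_iSup_subcritical`);
* `finRung_of_forall_subcritical`, `slitPeriods_eq_univ_of_forall_subcritical` and the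
  definition-free `finRung_of_forall_subcritical_lineSum_le_two`:
  **`[∀ p < p_c(ℤ³): Σ_{w ≠ 0} P_p(0 ↔ (0,0,w) inside ℍ) ≤ 2] ⟹ FinRung`.**

Every `T₀(p)`, `p < p_c`, is finite (sharpness of the phase transition); the content of the
hypothesis is uniformity as `p ↑ p_c`.  (For `p > p_c(ℤ³) = p_c(ℍ)` the sum is infinite, so the
value at `p_c` cannot be approached from above.)
-/

noncomputable section

namespace Summit.CriticalPhenomena.PercolationContinuityZ3.Theorems

open MeasureTheory Filter Topology Literature.Probability.Percolation Literature.Probability.LatticeModels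
open scoped ENNReal

/-! ### Local approximation of restricted connection events (general countable graphs) -/

section General

variable {V : Type*}

/-- `{x ↔ y via K} = ⋃_F {x ↔ y via K ⊓ F}` over finite edge sets `F`. -/
theorem openConnVia_eq_iUnion_inf_fromEdgeSet (K : SimpleGraph V) (x y : V) :
    openConnVia K x y =
      ⋃ F : Finset (Sym2 V), openConnVia (K ⊓ SimpleGraph.fromEdgeSet (↑F : Set (Sym2 V))) x y := by
  have h1 : ∀ F : Finset (Sym2 V),
      openConnVia (K ⊓ SimpleGraph.fromEdgeSet (↑F : Set (Sym2 V))) x y =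
        (fun ω : BondConfig V => ω ∩ K.edgeSet) ⁻¹'
          openConnVia (SimpleGraph.fromEdgeSet (↑F : Set (Sym2 V))) x y := by
    intro F
    ext ω
    simp only [openConnVia_eq_preimage, Set.mem_preimage, SimpleGraph.edgeSet_inf, Set.inter_assoc]
  rw [openConnVia_eq_preimage K, openConn_eq_iUnion_openConnVia_fromEdgeSet x y, Set.preimage_iUnion]
  exact Set.iUnion_congr fun F => (h1 F).symm

/-- The local approximants increase with `F`. -/
theorem monotone_openConnVia_inf_fromEdgeSet (K : SimpleGraph V) (x y : V) :
    Monotone fun F : Finset (Sym2 V) =>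
      openConnVia (K ⊓ SimpleGraph.fromEdgeSet (↑F : Set (Sym2 V))) x y :=
  fun _ _ h => openConnVia_mono_graph
    (inf_le_inf_left K (SimpleGraph.fromEdgeSet_mono (Finset.coe_subset.2 h))) x y

/-- The local approximant is determined by the edges of `F`. -/
theorem determinedBy_openConnVia_inf_fromEdgeSet (K : SimpleGraph V) (F : Finset (Sym2 V))
    (x y : V) :
    DeterminedBy (openConnVia (K ⊓ SimpleGraph.fromEdgeSet (↑F : Set (Sym2 V))) x y)
      (↑F : Set (Sym2 V)) :=
  (determinedBy_openConnVia _ x y).mono (by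
    rw [SimpleGraph.edgeSet_inf, SimpleGraph.edgeSet_fromEdgeSet]
    exact fun e he => he.2.1)

/-- `P_p(x ↔ y via K) = sup_F P_p(x ↔ y via K ⊓ F)` (continuity from below). -/
theorem measure_openConnVia_eq_iSup [Countable V] (G K : SimpleGraph V) (p : unitInterval)
    (x y : V) :
    bondPercolation G p (openConnVia K x y) =
      ⨆ F : Finset (Sym2 V),
        bondPercolation G p (openConnVia (K ⊓ SimpleGraph.fromEdgeSet (↑F : Set (Sym2 V))) x y) := by
  rw [openConnVia_eq_iUnion_inf_fromEdgeSet K x y,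
    (monotone_openConnVia_inf_fromEdgeSet K x y).measure_iUnion]

/-- Each local approximant has probability continuous in `p`. -/
theorem continuous_measure_openConnVia_inf_fromEdgeSet [Countable V] (G K : SimpleGraph V)
    (F : Finset (Sym2 V)) (x y : V) :
    Continuous fun p : unitInterval =>
      bondPercolation G p (openConnVia (K ⊓ SimpleGraph.fromEdgeSet (↑F : Set (Sym2 V))) x y) := by
  have h := continuous_bondPercolation_real_of_determinedBy G
    (determinedBy_openConnVia_inf_fromEdgeSet K F x y)
  have heq : (fun p : unitInterval =>
      bondPercolation G p (openConnVia (K ⊓ SimpleGraph.fromEdgeSet (↑F : Set (Sym2 V))) x y)) =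
      fun p => ENNReal.ofReal ((bondPercolation G p).real
        (openConnVia (K ⊓ SimpleGraph.fromEdgeSet (↑F : Set (Sym2 V))) x y)) :=
    funext fun p => (ofReal_measureReal (measure_ne_top _ _)).symm
  rw [heq]
  exact ENNReal.continuous_ofReal.comp h

/-- Restricted connection probabilities are non-decreasing in `p`. -/
theorem measure_openConnVia_mono [Countable V] (G K : SimpleGraph V) (x y : V) :
    Monotone fun p : unitInterval => bondPercolation G p (openConnVia K x y) := by
  intro p q hpq
  have h := DCT16.real_mono_of_isUpperSet G (isUpperSet_openConnVia K x y)
    (measurableSet_openConnVia K x y) hpq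
  exact (ENNReal.toReal_le_toReal (measure_ne_top _ _) (measure_ne_top _ _)).1 h

end General

/-! ### The `p`-dependent boundary-line sum -/

/-- `τ_ℍ^p(w) = P_p(0 ↔ (0,0,w) inside ℍ)`. -/
def tauHAt (p : unitInterval) (w : ℤ) : ℝ≥0∞ :=
  bondPercolation (zdGraph 3) p
    (openConnVia (withinGraph (zdGraph 3) hsp) (0 : Site 3) (Function.update (0 : Site 3) 2 w))

/-- `T₀(p) = Σ_{w ≠ 0} τ_ℍ^p(w)`. -/
def T0At (p : unitInterval) : ℝ≥0∞ := ∑' w : ℤ, Set.indicator {w : ℤ | w ≠ 0} (tauHAt p) w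

/-- At `p_c` these are the seat's `tauH`, `T0`. -/
theorem tauHAt_criticalProbI : tauHAt (criticalProbI 3) = tauH := rfl

/-- At `p_c`, `T₀(p_c) = T₀`. -/
theorem T0At_criticalProbI : T0At (criticalProbI 3) = T0 := rfl

/-- `τ_ℍ^p(w)` is non-decreasing in `p`. -/
theorem tauHAt_mono (w : ℤ) : Monotone fun p => tauHAt p w :=
  measure_openConnVia_mono (zdGraph 3) _ 0 _

/-- `T₀(p)` is non-decreasing in `p`. -/
theorem T0At_mono : Monotone T0At := by
  intro p q hpq
  refine ENNReal.tsum_le_tsum fun w => ?_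
  by_cases hw : w ∈ {w : ℤ | w ≠ 0}
  · rw [Set.indicator_of_mem hw, Set.indicator_of_mem hw]; exact tauHAt_mono w hpq
  · rw [Set.indicator_of_notMem hw, Set.indicator_of_notMem hw]

/-- `0 < p_c(ℤ³)` in `[0,1]`. -/
theorem criticalProbI_three_pos : (0 : unitInterval) < criticalProbI 3 := by
  have h : (0 : ℝ) < criticalProb (zdGraph 3) (0 : Site 3) := criticalProb_zd_pos 3 (by norm_num)
  exact_mod_cast h

/-- **Left-continuity transfer at `p_c`.** If `T₀(p) ≤ c` for all `p < p_c(ℤ³)` then `T₀ ≤ c`: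
`T₀` is a supremum of finite sums of local-event probabilities, each continuous in `p`. -/
theorem T0_le_of_forall_lt {c : ℝ≥0∞}
    (h : ∀ p : unitInterval, p < criticalProbI 3 → T0At p ≤ c) : T0 ≤ c := by
  classical
  set K := withinGraph (zdGraph 3) hsp with hK
  -- local approximants of `τ_ℍ^p(w)`
  set A : Finset (Sym2 (Site 3)) → ℤ → Set (BondConfig (Site 3)) := fun F w =>
    openConnVia (K ⊓ SimpleGraph.fromEdgeSet (↑F : Set (Sym2 (Site 3)))) (0 : Site 3)
      (Function.update (0 : Site 3) 2 w) with hA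
  unfold T0
  rw [ENNReal.tsum_eq_iSup_sum]
  refine iSup_le fun s => ?_
  -- the finite partial sum at `p_c` is a supremum over `F` of local sums
  have hrep : ∑ w ∈ s, Set.indicator {w : ℤ | w ≠ 0} tauH w =
      ⨆ F : Finset (Sym2 (Site 3)), ∑ w ∈ s, Set.indicator {w : ℤ | w ≠ 0} (fun w => Pc (A F w)) w := by
    rw [← ENNReal.finsetSum_iSup_of_monotone]
    · refine Finset.sum_congr rfl fun w _ => ?_
      by_cases hw : w ∈ {w : ℤ | w ≠ 0}
      · simp only [Set.indicator_of_mem hw]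
        exact measure_openConnVia_eq_iSup (zdGraph 3) K (criticalProbI 3) 0 _
      · simp only [Set.indicator_of_notMem hw]
        exact (ciSup_const (hι := ⟨∅⟩)).symm
    · intro w F F' hFF'
      by_cases hw : w ∈ {w : ℤ | w ≠ 0}
      · simp only [Set.indicator_of_mem hw]
        exact measure_mono (monotone_openConnVia_inf_fromEdgeSet K 0 _ hFF')
      · simp only [Set.indicator_of_notMem hw]; exact le_rfl
  rw [hrep]
  refine iSup_le fun F => ?_
  -- continuity in `p` of the local sum, and the bound below `p_c`
  set f : unitInterval → ℝ≥0∞ := fun p =>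
    ∑ w ∈ s, Set.indicator {w : ℤ | w ≠ 0} (fun w => bondPercolation (zdGraph 3) p (A F w)) w with hf
  have hcont : Continuous f := by
    refine continuous_finsetSum _ fun w _ => ?_
    by_cases hw : w ∈ {w : ℤ | w ≠ 0}
    · simp only [Set.indicator_of_mem hw]
      exact continuous_measure_openConnVia_inf_fromEdgeSet (zdGraph 3) K F 0 _
    · simp only [Set.indicator_of_notMem hw]; exact continuous_const
  have hclosed : IsClosed {p : unitInterval | f p ≤ c} := isClosed_le hcont continuous_const
  have hsub : Set.Iio (criticalProbI 3) ⊆ {p : unitInterval | f p ≤ c} := by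
    intro p hp
    refine le_trans ?_ (h p hp)
    refine le_trans (Finset.sum_le_sum fun w _ => ?_) (ENNReal.sum_le_tsum s)
    by_cases hw : w ∈ {w : ℤ | w ≠ 0}
    · simp only [Set.indicator_of_mem hw]
      exact measure_mono (openConnVia_mono_graph inf_le_left 0 _)
    · simp only [Set.indicator_of_notMem hw]; exact le_rfl
  have hne : (Set.Iio (criticalProbI 3)).Nonempty := ⟨0, criticalProbI_three_pos⟩
  have hmem : criticalProbI 3 ∈ closure (Set.Iio (criticalProbI 3)) := by
    rw [closure_Iio' hne]; exact Set.self_mem_Iic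
  exact hclosed.closure_subset_iff.2 hsub hmem

/-- **`T₀ = sup_{p < p_c} T₀(p)`**: the critical boundary-line sum is the increasing limit of the
subcritical ones. -/
theorem T0_eq_iSup_subcritical : T0 = ⨆ p : Set.Iio (criticalProbI 3), T0At p := by
  refine le_antisymm (T0_le_of_forall_lt fun p hp => le_iSup (fun q : Set.Iio (criticalProbI 3) =>
    T0At q) ⟨p, hp⟩) (iSup_le fun p => ?_)
  rw [← T0At_criticalProbI]
  exact T0At_mono (le_of_lt p.2)

/-- **FinRung from subcritical half-space percolation.** If `T₀(p) ≤ 2` for all `p < p_c(ℤ³)`,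
the half-space with a half-plane fin does not percolate at `p_c(ℤ³)`. -/
theorem finRung_of_forall_subcritical
    (h : ∀ p : unitInterval, p < criticalProbI 3 → T0At p ≤ 2) : SoloBlindOpenRungs.FinRung :=
  finRung_of_T0_le_two (T0_le_of_forall_lt h)

/-- Likewise every slit wall (and every periodic fin) is good. -/
theorem slitPeriods_eq_univ_of_forall_subcritical
    (h : ∀ p : unitInterval, p < criticalProbI 3 → T0At p ≤ 2) : slitPeriods = Set.univ :=
  slitPeriods_eq_univ_of_T0_le_two (T0_le_of_forall_lt h)

/-- **Definition-free form.** If for every `p < p_c(ℤ³)`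
`Σ_{w ≠ 0} P_p(0 ↔ (0,0,w) inside {0 ≤ x₀}) ≤ 2`, then
`θ_{ℤ³[{0 ≤ x₀} ∪ {x₁ = 0}]}(0, p_c(ℤ³)) = 0`. -/
theorem finRung_of_forall_subcritical_lineSum_le_two
    (h : ∀ p : unitInterval, p < criticalProbI 3 →
      ∑' w : ℤ, Set.indicator {w : ℤ | w ≠ 0}
        (fun w => bondPercolation (zdGraph 3) p
          (openConnVia (withinGraph (zdGraph 3) {x : Site 3 | 0 ≤ x 0}) 0 (Function.update 0 2 w))) w
        ≤ 2)
    (h0 : (0 : Site 3) ∈ {x : Site 3 | 0 ≤ x 0 ∨ x 1 = 0}) :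
    theta ((zdGraph 3).induce {x : Site 3 | 0 ≤ x 0 ∨ x 1 = 0}) ⟨0, h0⟩ (criticalProbI 3) = 0 :=
  finRung_of_forall_subcritical h h0

end Summit.CriticalPhenomena.PercolationContinuityZ3.Theorems

end
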